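import Mathlib
import Literature.Computability.Complexity.FourierTails
import Literature.Computability.Complexity.BooleanFourier
import HarnessLib

/-!
# Crux `MobiusLadder.LiouvilleOrthogonalTC0` (stmt-QuantumAdvantage-1393), line `Sketch`, skeleton v8:
stub `stub_phaseTail` (K1a) — Fourier tail of the Gelfond phase on the cube

For `α : ℝ` let `e(t) = exp(2πit)` and, on the cube `{0,1}ⁿ`, `f(y) = e(α|y|)` with `|y|` the number
of `true` coordinates. Writing `E = e(α)`, `A = (1 + E)/2`, `B = (1 - E)/2`, each bit contributes
`e(α[b]) = A + B·sgn b`, so `f(y) = ∏ᵢ (A + B sgn yᵢ) = ∑_T A^{n-|T|} B^{|T|} χ_T(y)` and the complex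
Walsh coefficient of `f` at `S` is `A^{n-|S|} B^{|S|}`, of squared modulus
`cos²(πα)^{n-|S|} sin²(πα)^{|S|}`. The real functions `cos(2πα|y|)`, `sin(2πα|y|)` are `Re f`, `Im f`,
so their coefficients are the real/imaginary parts and their squares are at most this modulus.
Summing over `|S| ≥ m` with the tilt `1 ≤ e^{|S|-m}` and the binomial theorem gives
`W^{≥m} ≤ e^{-m} (1 + (e-1) sin²(πα))ⁿ ≤ exp(2n sin²(πα) - m)`.
-/

set_option linter.dupNamespace false -- D-0017: single-problem summit ⇒ `QuantumAdvantage.QuantumAdvantage` by design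

noncomputable section

namespace Summit.QuantumAdvantage.QuantumAdvantage.Theorems.LiouvilleOrthogonalTC0

open Filter Finset
open Literature.Computability.Complexity.LowDegree (tailWeight cubeFourierCoeff)
open Literature.Probability.RandomGraphs.LowDegree (sgn walsh)

/-- One bit of the phase: `e^{iθ[b]} = B·sgn b + A` with `A = (1 + e^{iθ})/2`, `B = (1 - e^{iθ})/2`. [folklore] -/
theorem phaseTail_exp_bit (θ : ℝ) (b : Bool) :
    Complex.exp (((θ * (if b = true then (1 : ℝ) else 0) : ℝ) : ℂ) * Complex.I) =
      (1 - Complex.exp ((θ : ℂ) * Complex.I)) / 2 * (sgn b : ℂ) +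
        (1 + Complex.exp ((θ : ℂ) * Complex.I)) / 2 := by
  cases b
  · simp only [Bool.false_eq_true, if_false, mul_zero, Complex.ofReal_zero, zero_mul, Complex.exp_zero,
      Literature.Probability.RandomGraphs.LowDegree.sgn_false, Complex.ofReal_one]
    ring
  · simp only [if_true, mul_one, Literature.Probability.RandomGraphs.LowDegree.sgn_true, Complex.ofReal_neg,
      Complex.ofReal_one]
    ring

/-- The phase of the Hamming weight factorises over the coordinates:
`e^{iθ|y|} = ∏ᵢ e^{iθ[yᵢ]}`. [folklore] -/
theorem phaseTail_exp_card (n : ℕ) (θ : ℝ) (y : Fin n → Bool) :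
    Complex.exp (((θ * ((univ.filter fun i : Fin n => y i = true).card : ℝ) : ℝ) : ℂ) * Complex.I) =
      ∏ i, Complex.exp (((θ * (if y i = true then (1 : ℝ) else 0) : ℝ) : ℂ) * Complex.I) := by
  have hcard : (((univ.filter fun i : Fin n => y i = true).card : ℕ) : ℝ) =
      ∑ i, (if y i = true then (1 : ℝ) else 0) := by
    rw [Finset.card_filter]
    push_cast
    rfl
  rw [hcard, Finset.mul_sum, Complex.ofReal_sum, Finset.sum_mul, Complex.exp_sum]

/-- Walsh expansion of the phase: `e^{iθ|y|} = ∑_T A^{n-|T|} B^{|T|} χ_T(y)`. [folklore] -/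
theorem phaseTail_exp_expand (n : ℕ) (θ : ℝ) (y : Fin n → Bool) :
    Complex.exp (((θ * ((univ.filter fun i : Fin n => y i = true).card : ℝ) : ℝ) : ℂ) * Complex.I) =
      ∑ T : Finset (Fin n),
        ((1 + Complex.exp ((θ : ℂ) * Complex.I)) / 2) ^ (n - T.card) *
          ((1 - Complex.exp ((θ : ℂ) * Complex.I)) / 2) ^ T.card * (walsh T y : ℂ) := by
  rw [phaseTail_exp_card]
  simp_rw [phaseTail_exp_bit]
  rw [Fintype.prod_add]
  refine Finset.sum_congr rfl fun T _ => ?_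
  rw [Finset.prod_mul_distrib, Finset.prod_const, Finset.prod_const, Finset.card_compl,
    Fintype.card_fin, Literature.Probability.RandomGraphs.LowDegree.walsh, Complex.ofReal_prod]
  ring

/-- The complex Walsh coefficients of the phase: `∑_y e^{iθ|y|} χ_S(y) = 2ⁿ A^{n-|S|} B^{|S|}`
(orthogonality of characters). [folklore] -/
theorem phaseTail_sum_exp_mul_walsh (n : ℕ) (θ : ℝ) (S : Finset (Fin n)) :
    ∑ y : Fin n → Bool,
        Complex.exp (((θ * ((univ.filter fun i : Fin n => y i = true).card : ℝ) : ℝ) : ℂ) * Complex.I) *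
          (walsh S y : ℂ) =
      (((2 : ℝ) ^ n : ℝ) : ℂ) *
        (((1 + Complex.exp ((θ : ℂ) * Complex.I)) / 2) ^ (n - S.card) *
          ((1 - Complex.exp ((θ : ℂ) * Complex.I)) / 2) ^ S.card) := by
  have key : ∀ T : Finset (Fin n), ∑ y : Fin n → Bool, (walsh T y : ℂ) * (walsh S y : ℂ) =
      if T = S then (((2 : ℝ) ^ n : ℝ) : ℂ) else 0 := by
    intro T
    have h := congrArg (fun r : ℝ => (r : ℂ))
      (Literature.Computability.Complexity.LowDegree.sum_walsh_mul_walsh_index T S)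
    simp only [Complex.ofReal_sum, Complex.ofReal_mul] at h
    rw [h]
    split_ifs <;> simp
  calc ∑ y : Fin n → Bool,
        Complex.exp (((θ * ((univ.filter fun i : Fin n => y i = true).card : ℝ) : ℝ) : ℂ) * Complex.I) *
          (walsh S y : ℂ)
      = ∑ y : Fin n → Bool, ∑ T : Finset (Fin n),
          ((1 + Complex.exp ((θ : ℂ) * Complex.I)) / 2) ^ (n - T.card) *
            ((1 - Complex.exp ((θ : ℂ) * Complex.I)) / 2) ^ T.card * ((walsh T y : ℂ) * (walsh S y : ℂ)) := by
        refine Finset.sum_congr rfl fun y _ => ?_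
        rw [phaseTail_exp_expand, Finset.sum_mul]
        refine Finset.sum_congr rfl fun T _ => ?_
        ring
    _ = ∑ T : Finset (Fin n), ((1 + Complex.exp ((θ : ℂ) * Complex.I)) / 2) ^ (n - T.card) *
            ((1 - Complex.exp ((θ : ℂ) * Complex.I)) / 2) ^ T.card *
          ∑ y : Fin n → Bool, ((walsh T y : ℂ) * (walsh S y : ℂ)) := by
        rw [Finset.sum_comm]
        refine Finset.sum_congr rfl fun T _ => ?_
        rw [Finset.mul_sum]
    _ = ∑ T : Finset (Fin n), ((1 + Complex.exp ((θ : ℂ) * Complex.I)) / 2) ^ (n - T.card) *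
            ((1 - Complex.exp ((θ : ℂ) * Complex.I)) / 2) ^ T.card *
          (if T = S then (((2 : ℝ) ^ n : ℝ) : ℂ) else 0) := by
        refine Finset.sum_congr rfl fun T _ => ?_
        rw [key]
    _ = _ := by
        simp_rw [mul_ite, mul_zero]
        rw [Finset.sum_ite_eq']
        simp only [Finset.mem_univ, if_true]
        ring

/-- The cube Fourier coefficient of `y ↦ cos(θ|y|)` is the real part of the complex coefficient
`A^{n-|S|} B^{|S|}` of the phase. [folklore] -/
theorem phaseTail_coeff_cos (n : ℕ) (θ : ℝ) (S : Finset (Fin n)) :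
    cubeFourierCoeff (fun y : Fin n → Bool => Real.cos (θ * ((univ.filter fun i : Fin n => y i = true).card : ℝ))) S =
      (((1 + Complex.exp ((θ : ℂ) * Complex.I)) / 2) ^ (n - S.card) *
        ((1 - Complex.exp ((θ : ℂ) * Complex.I)) / 2) ^ S.card).re := by
  have h := congrArg Complex.re (phaseTail_sum_exp_mul_walsh n θ S)
  simp only [Complex.re_sum, Complex.re_mul_ofReal, Complex.exp_ofReal_mul_I_re, Complex.re_ofReal_mul] at h
  simp only [cubeFourierCoeff]
  rw [h, mul_div_cancel_left₀ _ (by positivity)]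

/-- The cube Fourier coefficient of `y ↦ sin(θ|y|)` is the imaginary part of the complex coefficient
`A^{n-|S|} B^{|S|}` of the phase. [folklore] -/
theorem phaseTail_coeff_sin (n : ℕ) (θ : ℝ) (S : Finset (Fin n)) :
    cubeFourierCoeff (fun y : Fin n → Bool => Real.sin (θ * ((univ.filter fun i : Fin n => y i = true).card : ℝ))) S =
      (((1 + Complex.exp ((θ : ℂ) * Complex.I)) / 2) ^ (n - S.card) *
        ((1 - Complex.exp ((θ : ℂ) * Complex.I)) / 2) ^ S.card).im := by
  have h := congrArg Complex.im (phaseTail_sum_exp_mul_walsh n θ S)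
  simp only [Complex.im_sum, Complex.im_mul_ofReal, Complex.exp_ofReal_mul_I_im, Complex.im_ofReal_mul] at h
  simp only [cubeFourierCoeff]
  rw [h, mul_div_cancel_left₀ _ (by positivity)]

/-- `(Re z)² ≤ |z|²`. [folklore] -/
theorem phaseTail_re_sq_le (z : ℂ) : z.re ^ 2 ≤ Complex.normSq z := by
  rw [Complex.normSq_apply]; nlinarith [mul_self_nonneg z.im]

/-- `(Im z)² ≤ |z|²`. [folklore] -/
theorem phaseTail_im_sq_le (z : ℂ) : z.im ^ 2 ≤ Complex.normSq z := by
  rw [Complex.normSq_apply]; nlinarith [mul_self_nonneg z.re]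

/-- `|(1 + e(α))/2|² = cos²(πα)`. [folklore] -/
theorem phaseTail_normSq_A (α : ℝ) :
    Complex.normSq ((1 + Complex.exp (((2 * Real.pi * α : ℝ) : ℂ) * Complex.I)) / 2) =
      Real.cos (Real.pi * α) ^ 2 := by
  rw [Complex.normSq_apply]
  simp only [Complex.div_ofNat_re, Complex.div_ofNat_im, Complex.add_re, Complex.add_im, Complex.one_re,
    Complex.one_im, Complex.exp_ofReal_mul_I_re, Complex.exp_ofReal_mul_I_im]
  have hc : Real.cos (2 * Real.pi * α) = 2 * Real.cos (Real.pi * α) ^ 2 - 1 := by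
    rw [mul_assoc, Real.cos_two_mul]
  have hs : Real.sin (2 * Real.pi * α) ^ 2 = 1 - Real.cos (2 * Real.pi * α) ^ 2 := Real.sin_sq _
  linear_combination (1 / 4 : ℝ) * hs + (1 / 2 : ℝ) * hc

/-- `|(1 - e(α))/2|² = sin²(πα)`. [folklore] -/
theorem phaseTail_normSq_B (α : ℝ) :
    Complex.normSq ((1 - Complex.exp (((2 * Real.pi * α : ℝ) : ℂ) * Complex.I)) / 2) =
      Real.sin (Real.pi * α) ^ 2 := by
  rw [Complex.normSq_apply]
  simp only [Complex.div_ofNat_re, Complex.div_ofNat_im, Complex.sub_re, Complex.sub_im, Complex.one_re,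
    Complex.one_im, Complex.exp_ofReal_mul_I_re, Complex.exp_ofReal_mul_I_im]
  have hc : Real.cos (2 * Real.pi * α) = 2 * Real.cos (Real.pi * α) ^ 2 - 1 := by
    rw [mul_assoc, Real.cos_two_mul]
  have hs : Real.sin (2 * Real.pi * α) ^ 2 = 1 - Real.cos (2 * Real.pi * α) ^ 2 := Real.sin_sq _
  have hs2 : Real.sin (Real.pi * α) ^ 2 = 1 - Real.cos (Real.pi * α) ^ 2 := Real.sin_sq _
  linear_combination (1 / 4 : ℝ) * hs - (1 / 2 : ℝ) * hc - hs2

/-- Coefficient bound for the real part: `ĉos(S)² ≤ cos²(πα)^{n-|S|} sin²(πα)^{|S|}`. [folklore] -/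
theorem phaseTail_coeff_cos_sq_le (n : ℕ) (α : ℝ) (S : Finset (Fin n)) :
    cubeFourierCoeff (fun y : Fin n → Bool =>
        Real.cos (2 * Real.pi * α * ((univ.filter fun i : Fin n => y i = true).card : ℝ))) S ^ 2 ≤
      (Real.cos (Real.pi * α) ^ 2) ^ (n - S.card) * (Real.sin (Real.pi * α) ^ 2) ^ S.card := by
  have h := phaseTail_re_sq_le
    (((1 + Complex.exp (((2 * Real.pi * α : ℝ) : ℂ) * Complex.I)) / 2) ^ (n - S.card) *
      ((1 - Complex.exp (((2 * Real.pi * α : ℝ) : ℂ) * Complex.I)) / 2) ^ S.card)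
  rwa [Complex.normSq_mul, map_pow, map_pow, phaseTail_normSq_A, phaseTail_normSq_B,
    ← phaseTail_coeff_cos n (2 * Real.pi * α) S] at h

/-- Coefficient bound for the imaginary part: `ŝin(S)² ≤ cos²(πα)^{n-|S|} sin²(πα)^{|S|}`. [folklore] -/
theorem phaseTail_coeff_sin_sq_le (n : ℕ) (α : ℝ) (S : Finset (Fin n)) :
    cubeFourierCoeff (fun y : Fin n → Bool =>
        Real.sin (2 * Real.pi * α * ((univ.filter fun i : Fin n => y i = true).card : ℝ))) S ^ 2 ≤
      (Real.cos (Real.pi * α) ^ 2) ^ (n - S.card) * (Real.sin (Real.pi * α) ^ 2) ^ S.card := by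
  have h := phaseTail_im_sq_le
    (((1 + Complex.exp (((2 * Real.pi * α : ℝ) : ℂ) * Complex.I)) / 2) ^ (n - S.card) *
      ((1 - Complex.exp (((2 * Real.pi * α : ℝ) : ℂ) * Complex.I)) / 2) ^ S.card)
  rwa [Complex.normSq_mul, map_pow, map_pow, phaseTail_normSq_A, phaseTail_normSq_B,
    ← phaseTail_coeff_sin n (2 * Real.pi * α) S] at h

/-- **Tilt.** For `0 ≤ s ≤ 1`, `∑_{|S| ≥ m} (1-s)^{n-|S|} s^{|S|} ≤ exp(2ns - m)`: insert
`1 ≤ e^{|S|-m}`, extend to all `S`, use the binomial theorem and `1 + (e-1)s ≤ exp((e-1)s)`,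
`e - 1 ≤ 2`. [folklore] -/
theorem phaseTail_tilt (n m : ℕ) {s : ℝ} (hs0 : 0 ≤ s) (hs1 : s ≤ 1) :
    ∑ S ∈ (univ : Finset (Finset (Fin n))).filter (fun S => m ≤ S.card), (1 - s) ^ (n - S.card) * s ^ S.card ≤
      Real.exp (2 * n * s - m) := by
  calc ∑ S ∈ (univ : Finset (Finset (Fin n))).filter (fun S => m ≤ S.card), (1 - s) ^ (n - S.card) * s ^ S.card
      ≤ ∑ S ∈ (univ : Finset (Finset (Fin n))).filter (fun S => m ≤ S.card),
          Real.exp (-m) * ((Real.exp 1 * s) ^ S.card * (1 - s) ^ (n - S.card)) := by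
        refine Finset.sum_le_sum fun S hS => ?_
        simp only [Finset.mem_filter, Finset.mem_univ, true_and] at hS
        have hS' : (m : ℝ) ≤ S.card := by exact_mod_cast hS
        have h1 : (1 : ℝ) ≤ Real.exp (-m) * Real.exp 1 ^ S.card := by
          rw [Real.exp_one_pow, ← Real.exp_add]
          exact Real.one_le_exp (by linarith)
        have ht : (0 : ℝ) ≤ (1 - s) ^ (n - S.card) * s ^ S.card :=
          mul_nonneg (pow_nonneg (by linarith) _) (pow_nonneg hs0 _)
        calc (1 - s) ^ (n - S.card) * s ^ S.card = 1 * ((1 - s) ^ (n - S.card) * s ^ S.card) := (one_mul _).symm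
          _ ≤ (Real.exp (-m) * Real.exp 1 ^ S.card) * ((1 - s) ^ (n - S.card) * s ^ S.card) :=
              mul_le_mul_of_nonneg_right h1 ht
          _ = Real.exp (-m) * ((Real.exp 1 * s) ^ S.card * (1 - s) ^ (n - S.card)) := by ring
    _ ≤ ∑ S : Finset (Fin n), Real.exp (-m) * ((Real.exp 1 * s) ^ S.card * (1 - s) ^ (n - S.card)) :=
        Finset.sum_le_sum_of_subset_of_nonneg (Finset.filter_subset _ _) fun S _ _ =>
          mul_nonneg (Real.exp_pos _).le
            (mul_nonneg (pow_nonneg (mul_nonneg (Real.exp_pos 1).le hs0) _) (pow_nonneg (by linarith) _))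
    _ = Real.exp (-m) * (Real.exp 1 * s + (1 - s)) ^ n := by
        rw [← Finset.mul_sum, Fin.sum_pow_mul_eq_add_pow]
    _ ≤ Real.exp (-m) * Real.exp (2 * n * s) := by
        refine mul_le_mul_of_nonneg_left ?_ (Real.exp_pos _).le
        calc (Real.exp 1 * s + (1 - s)) ^ n ≤ Real.exp ((Real.exp 1 - 1) * s) ^ n := by
              refine pow_le_pow_left₀ (add_nonneg (mul_nonneg (Real.exp_pos 1).le hs0) (by linarith)) ?_ n
              have := Real.add_one_le_exp ((Real.exp 1 - 1) * s)
              linarith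
          _ = Real.exp (n * ((Real.exp 1 - 1) * s)) := (Real.exp_nat_mul _ _).symm
          _ ≤ Real.exp (2 * n * s) := by
              rw [Real.exp_le_exp]
              have he : Real.exp 1 - 1 ≤ 2 := by
                have := Real.exp_one_lt_d9; norm_num at this; linarith
              have hn : (0 : ℝ) ≤ n := n.cast_nonneg
              nlinarith [mul_nonneg hn hs0]
    _ = Real.exp (2 * n * s - m) := by
        rw [← Real.exp_add]
        congr 1
        ring

/-- **K1a, Fourier tail of the Gelfond phase on the cube.** For the real and imaginary parts
`y ↦ cos(2πα|y|)`, `y ↦ sin(2πα|y|)` of the phase `e(α|y|)` on `{0,1}ⁿ` (`|y|` = number of `true`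
coordinates), the Walsh tail weight above level `m` is at most `exp(2n sin²(πα) - m)`: the complex
coefficient at `S` is `A^{n-|S|}B^{|S|}` with `|A|² = cos²(πα)`, `|B|² = sin²(πα)`, and
`∑_{|S| ≥ m} cos²^{n-|S|} sin²^{|S|} ≤ e^{-m}(1 + (e-1)sin²)ⁿ ≤ exp(2n sin² - m)`. [folklore] -/
theorem stub_phaseTail (n m : ℕ) (α : ℝ) :
    tailWeight (fun y : Fin n → Bool =>
        Real.cos (2 * Real.pi * α * ((Finset.univ.filter fun i : Fin n => y i = true).card : ℝ))) m
        ≤ Real.exp (2 * n * Real.sin (Real.pi * α) ^ 2 - m) ∧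
      tailWeight (fun y : Fin n → Bool =>
        Real.sin (2 * Real.pi * α * ((Finset.univ.filter fun i : Fin n => y i = true).card : ℝ))) m
        ≤ Real.exp (2 * n * Real.sin (Real.pi * α) ^ 2 - m) := by
  have ht := phaseTail_tilt n m (sq_nonneg (Real.sin (Real.pi * α))) (Real.sin_sq_le_one (Real.pi * α))
  rw [← Real.cos_sq'] at ht
  constructor
  · refine le_trans ?_ ht
    simp only [tailWeight]
    exact Finset.sum_le_sum fun S _ => phaseTail_coeff_cos_sq_le n α S
  · refine le_trans ?_ ht
    simp only [tailWeight]
    exact Finset.sum_le_sum fun S _ => phaseTail_coeff_sin_sq_le n α S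

end Summit.QuantumAdvantage.QuantumAdvantage.Theorems.LiouvilleOrthogonalTC0
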